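import Summits.QuantumFields.YangMills.Theorems.FluctuationComparisonRegPrIntLS2BetaLiftCurvatureLocalTower
import Summits.QuantumFields.YangMills.Theorems.FluctuationComparisonRegPrIntLS2BetaParentBoxReadCover
import Summits.QuantumFields.YangMills.Theorems.FluctuationComparisonRegPrIntLS2BetaRhoPColumnRead
import HarnessLib

/-!
# S2β · THE SUP CHAIN ∕ (D-stage) — THE `ρA` COLUMN, PART 2: THE PARENT BOX SUPS ARE READ — `mC_par(t,B) ≤ ‖𝟙[PBOX³_t(B)]·η_{J+t}‖` (⟹ (k2′) + ✓`mShare_le`)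
# and `ρP_par(t,B) ≤` px10's (k1) read cell ONE LEVEL UP; plus the `t = 0` vanishing lemmas and the support geometry of the Whitney hat

Cell `ym3-torus` (YM ladder rung R3 = continuum `SU(2)` Yang–Mills on the three-torus at fixed lattice data — a RUNG: NOT d = 4, NOT infinite volume,
NOT a mass gap, NOT Clay).  Width seat «width 21» `ym3-torus-px21` (gen 25), FREE px helper on crux `stmt-QuantumFields-20520`
(`…Theses.UnitScaleTilt.FluctuationComparisonRegPrIntL`), LINE g18-1 S2β.  px12 g26 2026-08-31 23:15:14Z: «the ρA column is yours to assemble» — PART 1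
✓∕⧗`…RhoAColumnLocal` fixed the objects `ρP_par`, `mC_par` (Pi-sups over R′'s supports); THIS PART proves they are dominated by the two budgeted currencies.
`--kind proof --supports stmt-QuantumFields-20520 --as helper`, count-neutral, DEFINITION-FREE (0 `def`, 0 `instance`, 0 `notation`, 0 `sorry`, default heartbeats).

WHAT IS PROVED (sorry-free).
§1 support geometry (generic `Params`): ★`natAbs_rel_blockOf_le_one_of_colW` (a column plaquette of the cube column through `x` sits within one block of `blockOf x`:
   ✓`colW_support` + ✓`natAbs_rel_blockOf_le_one` + lit ✓`blockOf_emb`), ★`natAbs_rel_blockOf_le_one_of_wt` (a hat feeder of `b` sits within one block of `blockOf b₋`: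
   ✓`hatW_support`), `natAbs_rel_corner_le_one`.
§2 `t = 0` vanishing for the consumer: `piSup_relPlaq_eq_zero_of_eq`, `piSup_relChord_eq_zero_of_eq` (equal fields ⇒ every truncated relative sup is `0`; at
   `t = 0` the parent pair coincides on the fibre by (E4) + ✓`iter_eq_of_descendTo_eq`).
§3 ★★★`mCpar_le_parentBoxSup (U₀ ζ wt hwt t ht B)`: PART 1's `mC_par(t,B)` ≤ ✓p837136's parent-box Pi-sup at radius `3` with `g := η_{J+t}` (px20's `M` integrand) —
   so by ✓`sum_sq_parentBoxSup_le_readSup J t 3 η_{J+t}`: `Σ_B mC_par(t,B)² ≤ (2·d·13^d)·Σ_B M(t,B)²`, and ✓`mShare_le` pays it with `L·S′`.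
   ★★`rhoPpar_le_readCellParent (U₀ ζ t ht B)`: PART 1's `ρP_par(t,B)` ≤ px10 g26's (k1) read-cell sup (✓p addef449 `hρT_of_readSup`'s object) written at the PARENT
   height `s+1` — the (k1) budget one level up pays it (index shift `t = t′+1`, `L·`(k1)).

HONEST SCOPE.  Finite torus bookkeeping + one currency identity; nothing of Bałaban's renormalisation-group analysis is asserted or proved ([Balaban1987RG1]
(0.1)–(0.4), (0.11) pp.251–253; [Balaban1985RegularSpaces] (1.29) p.81); the ρA∕ρ̃-column BUDGET arithmetic, (SRC-P), `hArc`, (ST⁗)∕LOC⁗, GAP♯∘ (`stub_uniformFibreGapOrbit`,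
registry 3732b7df UNTOUCHED), the five registered stubs (0∕5), S2β, 20520, 19936, 19200, `YM3TorusSU2` are NOT proved; no registered stub is closed; rung R3 — NOT d = 4,
NOT infinite volume, NOT a mass gap, NOT Clay; the Yang–Mills mass gap is NOT proved.
-/

set_option autoImplicit false

namespace Summit.QuantumFields.YangMills.Theorems.FluctuationComparisonRegPrIntLS2BetaRhoAColumnCovers

open Finset
open scoped Real
open Literature.MathematicalPhysics.QuantumLattice (su2Quat)
open Literature.MathematicalPhysics.QuantumFieldTheory.Balaban1983to89
open T4Continuum T3ContinuumYM3Torus T3TiltDescent T3LevelShift BlockAveraging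
open B10Eq27TorusAxialLog (rel rel_apply rel_self)
open T4CubeChartGnomonic (SU2)
open T4HaarSU2ExpChart (expPoint)
open T4ExpWindowSmallField (logVec)
open T3UnitLawDensityEML (ℰp)
open Summit.QuantumFields.YangMills.Theorems.FluctuationComparisonRegPrIntLS2BetaReadNesting (natAbs_rel_le_add natAbs_rel_comm natAbs_rel_blockOf_le_one)
open Summit.QuantumFields.YangMills.Theorems.FluctuationComparisonRegPrIntLS2BetaTorusCellClasses (natAbs_rel_blockOf_le natAbs_rel_blockOf_le_of_le_mul)
open Summit.QuantumFields.YangMills.Theorems.FluctuationComparisonRegPrIntLS2BetaLiftLadderCombRowTower (natAbs_rel_siteShift descendTo_apply_eq_iter_of_eq)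
open Summit.QuantumFields.YangMills.Theorems.FluctuationComparisonRegPrIntLS2BetaBlockPairReadCover (natAbs_rel_shift_le_one natAbs_rel_of_boxBlock)
open Summit.QuantumFields.YangMills.Theorems.FluctuationComparisonRegPrIntLS2BetaWhitneyHatCurl (colW_support)
open Summit.QuantumFields.YangMills.Theorems.FluctuationComparisonRegPrIntLS2BetaWhitneyHatWeights (hatW_support)
open Summit.QuantumFields.YangMills.Theorems.FluctuationComparisonRegPrIntLS2BetaGeodesicJensenLift (dist1_le_norm_logVec)
open Summit.QuantumFields.YangMills.Theorems.FluctuationComparisonRegPrIntLS2BetaRhoPColumnRead (readCell_of_box)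

/-! ## §1 Support geometry: column plaquettes and hat feeders sit within one block -/

section Support

variable {P : Params} {k : ℕ}

/-- ★ **A COLUMN PLAQUETTE SITS WITHIN ONE BLOCK**: `colW(x; μ, ν; y) ≠ 0 ⟹ |rel y (blockOf x)|_κ ≤ 1` for all `κ` (✓`colW_support`: `x` in the half-open slabs of `y` and
within hat range transversally, so `|rel (emb y) x|_κ ≤ L`; ✓`natAbs_rel_blockOf_le_one`; lit ✓`blockOf_emb`). [folklore] -/
theorem natAbs_rel_blockOf_le_one_of_colW (hk : k + 1 ≤ P.m + P.K) {x : Site P k} {μ ν : Fin P.d} {y : Site P (k + 1)}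
    (h : (if (x μ - emb y μ).val < P.L then (1 : ℝ) else 0) *
      (∏ ι ∈ (Finset.univ.erase μ).erase ν, max 0 (1 - ((rel (emb y) x ι).natAbs : ℝ) / P.L)) *
      (if (x ν - emb y ν).val < P.L then (1 : ℝ) else 0) ≠ 0) (κ : Fin P.d) :
    (rel y (blockOf x) κ).natAbs ≤ 1 := by
  obtain ⟨hμ, hν, hoth⟩ := colW_support hk h
  have hL : (rel (emb y) x κ).natAbs ≤ P.L := by
    by_cases h1 : κ = μ
    · subst h1; omega
    by_cases h2 : κ = ν
    · subst h2; omega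
    exact (hoth κ h1 h2).le
  have := natAbs_rel_blockOf_le_one hk (emb y) x κ hL
  rwa [Site.blockOf_emb hk] at this

/-- ★ **A HAT FEEDER SITS WITHIN ONE BLOCK**: `w b e ≠ 0 ⟹ |rel e.src (blockOf b.src)|_κ ≤ 1` for all `κ` (✓`hatW_support`). [folklore] -/
theorem natAbs_rel_blockOf_le_one_of_wt (hk : k + 1 ≤ P.m + P.K) (w : PBond P k → PBond P (k + 1) → ℝ)
    (hw : ∀ b e, w b e = if e.dir = b.dir ∧ (b.src b.dir - emb e.src b.dir).val < P.L then
      ∏ ν ∈ Finset.univ.erase b.dir, max 0 (1 - ((rel (emb e.src) b.src ν).natAbs : ℝ) / P.L) else 0)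
    {b : PBond P k} {e : PBond P (k + 1)} (hbe : w b e ≠ 0) (κ : Fin P.d) :
    (rel e.src (blockOf b.src) κ).natAbs ≤ 1 := by
  obtain ⟨-, hdir, hoth⟩ := hatW_support hk w hw hbe
  have hL : (rel (emb e.src) b.src κ).natAbs ≤ P.L := by
    by_cases h1 : κ = b.dir
    · rw [h1]; omega
    exact (hoth κ h1).le
  have := natAbs_rel_blockOf_le_one hk (emb e.src) b.src κ hL
  rwa [Site.blockOf_emb hk] at this

/-- `|rel x b|_κ ≤ 1` when `b` is `x` or a unit step from `x` (the sources of the four bonds of a plaquette at `x`). [folklore] -/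
theorem natAbs_rel_corner_le_one (x : Site P k) (μ ν : Fin P.d) {s : Site P k}
    (h : s = x ∨ s = x.shift μ ∨ s = x.shift ν) (κ : Fin P.d) : (rel x s κ).natAbs ≤ 1 := by
  rcases h with h | h | h
  · rw [h, rel_self]; simp
  · rw [h]; exact natAbs_rel_shift_le_one x μ κ
  · rw [h]; exact natAbs_rel_shift_le_one x ν κ

end Support

/-! ## §2 Vanishing sups (the consumer's `t = 0` term: the parent pair coincides on the fibre) -/

section Vanishing

variable {P : Params} {n : ℕ} {ι : Type*} [Fintype ι]

/-- If the two fields coincide, every truncated Pi-sup of their relative plaquettes vanishes. [folklore] -/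
theorem piSup_relPlaq_eq_zero_of_eq (V W : GaugeField P n SU2) (h : W = V) (PR : Plaq P n → Prop) [DecidablePred PR] :
    ‖(fun p : Plaq P n => if PR p then dist1 ((GaugeField.plaqHol V p)⁻¹ * GaugeField.plaqHol W p) else (0 : ℝ))‖ = 0 := by
  subst h
  have : (fun p : Plaq P n => if PR p then dist1 ((GaugeField.plaqHol W p)⁻¹ * GaugeField.plaqHol W p) else (0 : ℝ)) = 0 := by
    funext p
    simp [inv_mul_cancel, GaugeGroup.dist1_one]
  rw [this, norm_zero]

/-- If the two fields coincide, every truncated Pi-sup of their relative chords vanishes. [folklore] -/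
theorem piSup_relChord_eq_zero_of_eq (V W : GaugeField P n SU2) (h : W = V) (PR : PBond P n → Prop) [DecidablePred PR] :
    ‖(fun e : PBond P n => if PR e then dist1 (W e * (V e)⁻¹) else (0 : ℝ))‖ = 0 := by
  subst h
  have : (fun e : PBond P n => if PR e then dist1 (W e * (W e)⁻¹) else (0 : ℝ)) = 0 := by
    funext e
    simp [mul_inv_cancel, GaugeGroup.dist1_one]
  rw [this, norm_zero]

end Vanishing

/-! ## §3 At the tower: the parent box sups are read by the parent READ′ sets ∕ the (k1) read cell one level up -/

section Tower

variable {F : T3Family}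

/-- ★★★ **`mC_par(t,B) ≤ ‖𝟙[PBOX³_t(B)]·η_{J+t}‖`** — the parent relative-chord box sup of ✓∕⧗`…RhoAColumnLocal.hρA_of_parentSups` (R′'s supports: the four bonds of the column
plaquettes `colW ≠ 0` through a region plaquette, and the hat feeders `wt s b e ≠ 0` of its four bonds) is dominated by the PARENT-BOX Pi-sup of ✓p837136
`sum_sq_parentBoxSup_le_readSup` at radius `r = 3` with `g := η_{J+t}` = px20's parent integrand (so `Σ_B mC_par(t,B)² ≤ 13182·Σ_B M(t,B)²` and ✓`mShare_le`).  Geometry: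
§1 (each support bond within one block of `blockOf q.src`, `q` within one block of the box block `blockOf (σ₂ℓ′)₋`); currency: `Ū^{s+1} X e = D_{J+t,K} X (σ⁻¹e)`
(✓`descendTo_apply_eq_iter_of_eq`) and chord ≤ arc (✓`dist1_le_norm_logVec`). [cite: Balaban1987RG1, (0.1)-(0.4), (0.11) p.251-253; Balaban1985RegularSpaces, (1.29) p.81] -/
theorem mCpar_le_parentBoxSup {J K : ℕ} (U₀ : GaugeField (F.P K) 0 (Matrix.specialUnitaryGroup (Fin 2) ℂ)) (ζ : PBond (F.P K) 0 → EuclideanSpace ℝ (Fin 3))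
    (wt : (j : ℕ) → PBond (F.P K) j → PBond (F.P K) (j + 1) → ℝ)
    (hwt : ∀ j b e, wt j b e = if e.dir = b.dir ∧ (b.src b.dir - emb e.src b.dir).val < (F.P K).L then
        ∏ ν ∈ Finset.univ.erase b.dir, max 0 (1 - ((rel (emb e.src) b.src ν).natAbs : ℝ) / (F.P K).L) else 0)
    (t : ℕ) (ht : t < K - J) (B : PBond (F.P J) 0) :
    ‖(fun e : PBond (F.P K) ((K - (J + (t + 1))) + 1) => if (∃ q : Plaq (F.P K) (K - (J + (t + 1))), ((∃ ℓ' : PBond (F.P (J + (t + 1))) 0, (∃ z : Site (F.P (J + (t + 1))) 0,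
                (B14.Eq22Determines.blockIter (t + 1) z = (bondShift (F.sitesPerDir_eq (m := F.m) (K := J) (j := 0) (m' := F.m) (K' := J + (t + 1)) (j' := t + 1) (by omega)) B).src ∨ B14.Eq22Determines.blockIter (t + 1) z = (bondShift (F.sitesPerDir_eq (m := F.m) (K := J) (j := 0) (m' := F.m) (K' := J + (t + 1)) (j' := t + 1) (by omega)) B).tgt) ∧
                ∀ ν, (B10Eq27TorusAxialLog.rel z ℓ'.src ν).natAbs ≤ 2) ∧
        (blockOf q.src = blockOf (bondShift (F.sitesPerDir_eq (m := F.m) (K := J + (t + 1)) (j := 0) (m' := F.m) (K' := K) (j' := (K - (J + (t + 1)))) (by omega)) ℓ').src ∨ blockOf q.src = (blockOf (bondShift (F.sitesPerDir_eq (m := F.m) (K := J + (t + 1)) (j := 0) (m' := F.m) (K' := K) (j' := (K - (J + (t + 1)))) (by omega)) ℓ').src).shift (bondShift (F.sitesPerDir_eq (m := F.m) (K := J + (t + 1)) (j := 0) (m' := F.m) (K' := K) (j' := (K - (J + (t + 1)))) (by omega)) ℓ').dir))) ∧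
          ((∃ y : Site (F.P K) ((K - (J + (t + 1))) + 1), (if (q.src q.μ - emb y q.μ).val < (F.P K).L then (1 : ℝ) else 0) *
          (∏ ι ∈ (Finset.univ.erase q.μ).erase q.ν, max 0 (1 - ((rel (emb y) q.src ι).natAbs : ℝ) / (F.P K).L)) *
          (if (q.src q.ν - emb y q.ν).val < (F.P K).L then (1 : ℝ) else 0) ≠ 0 ∧ (e = ⟨y, q.μ⟩ ∨ e = ⟨y.shift q.μ, q.ν⟩ ∨ e = ⟨y.shift q.ν, q.μ⟩ ∨ e = ⟨y, q.ν⟩)) ∨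
           (∃ b : PBond (F.P K) (K - (J + (t + 1))), (b = ⟨q.src, q.μ⟩ ∨ b = ⟨q.src.shift q.μ, q.ν⟩ ∨ b = ⟨q.src.shift q.ν, q.μ⟩ ∨ b = ⟨q.src, q.ν⟩) ∧ wt (K - (J + (t + 1))) b e ≠ 0))) then dist1 ((Averaging.iter (fun k => blockAvg (P := F.P K) (j := k) ℰp) ((K - (J + (t + 1))) + 1) (fun ℓ => expPoint (ζ ℓ) * U₀ ℓ : GaugeField (F.P K) 0 (Matrix.specialUnitaryGroup (Fin 2) ℂ))) e * ((Averaging.iter (fun k => blockAvg (P := F.P K) (j := k) ℰp) ((K - (J + (t + 1))) + 1) U₀) e)⁻¹) else 0)‖ ≤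
      ‖(fun c : PBond (F.P (J + t)) 0 =>
        if ∃ ℓ' : PBond (F.P (J + (t + 1))) 0, (∃ ℓ'' : PBond (F.P (J + (t + 1))) 0, (∃ z : Site (F.P (J + (t + 1))) 0,
                (B14.Eq22Determines.blockIter (t + 1) z = (bondShift (F.sitesPerDir_eq (m := F.m) (K := J) (j := 0) (m' := F.m) (K' := J + (t + 1)) (j' := t + 1) (by omega)) B).src ∨ B14.Eq22Determines.blockIter (t + 1) z = (bondShift (F.sitesPerDir_eq (m := F.m) (K := J) (j := 0) (m' := F.m) (K' := J + (t + 1)) (j' := t + 1) (by omega)) B).tgt) ∧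
                ∀ ν, (B10Eq27TorusAxialLog.rel z ℓ''.src ν).natAbs ≤ 2) ∧
                (blockOf ℓ'.src = (blockOf ℓ''.src).unshift ℓ''.dir ∨ blockOf ℓ'.src = blockOf ℓ''.src ∨ blockOf ℓ'.src = (blockOf ℓ''.src).shift ℓ''.dir)) ∧
                ∀ ν, (B10Eq27TorusAxialLog.rel ((siteShift (F.sitesPerDir_eq (m := F.m) (K := J + t) (j := 0) (m' := F.m) (K' := J + (t + 1)) (j' := 1) (by omega))).symm (blockOf ℓ'.src)) c.src ν).natAbs ≤ 3
        then logVec (su2Quat (descendTo F ℰp (J + t) K (by omega) (fun ℓ => expPoint (ζ ℓ) * U₀ ℓ : GaugeField (F.P K) 0 (Matrix.specialUnitaryGroup (Fin 2) ℂ)) c * (descendTo F ℰp (J + t) K (by omega) U₀ c)⁻¹)) else 0)‖ := by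
  classical
  -- standing ranges and level identifications
  have hs1 : (K - (J + (t + 1))) + 1 ≤ (F.P K).m + (F.P K).K := by show (K - (J + (t + 1))) + 1 ≤ F.m + K; omega
  have ha : (K - (J + (t + 1))) + 1 = K - (J + t) := by omega
  have hJt : J + t ≤ K := by omega
  have Pσ : (F.P (J + t)).sitesPerDir 0 = (F.P K).sitesPerDir ((K - (J + (t + 1))) + 1) := F.sitesPerDir_eq (by omega)
  have H : (F.P (J + t)).sitesPerDir 0 = (F.P (J + (t + 1))).sitesPerDir 1 := F.sitesPerDir_eq (by omega)
  have H₁ : (F.P (J + (t + 1))).sitesPerDir 1 = (F.P K).sitesPerDir ((K - (J + (t + 1))) + 1) := F.sitesPerDir_eq (by omega)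
  have P₂ : (F.P (J + (t + 1))).sitesPerDir 0 = (F.P K).sitesPerDir (K - (J + (t + 1))) := F.sitesPerDir_eq (by omega)
  refine (pi_norm_le_iff_of_nonneg (norm_nonneg _)).mpr fun e => ?_
  by_cases hs : ∃ q : Plaq (F.P K) (K - (J + (t + 1))), ((∃ ℓ' : PBond (F.P (J + (t + 1))) 0, (∃ z : Site (F.P (J + (t + 1))) 0,
                (B14.Eq22Determines.blockIter (t + 1) z = (bondShift (F.sitesPerDir_eq (m := F.m) (K := J) (j := 0) (m' := F.m) (K' := J + (t + 1)) (j' := t + 1) (by omega)) B).src ∨ B14.Eq22Determines.blockIter (t + 1) z = (bondShift (F.sitesPerDir_eq (m := F.m) (K := J) (j := 0) (m' := F.m) (K' := J + (t + 1)) (j' := t + 1) (by omega)) B).tgt) ∧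
                ∀ ν, (B10Eq27TorusAxialLog.rel z ℓ'.src ν).natAbs ≤ 2) ∧
        (blockOf q.src = blockOf (bondShift (F.sitesPerDir_eq (m := F.m) (K := J + (t + 1)) (j := 0) (m' := F.m) (K' := K) (j' := (K - (J + (t + 1)))) (by omega)) ℓ').src ∨ blockOf q.src = (blockOf (bondShift (F.sitesPerDir_eq (m := F.m) (K := J + (t + 1)) (j := 0) (m' := F.m) (K' := K) (j' := (K - (J + (t + 1)))) (by omega)) ℓ').src).shift (bondShift (F.sitesPerDir_eq (m := F.m) (K := J + (t + 1)) (j := 0) (m' := F.m) (K' := K) (j' := (K - (J + (t + 1)))) (by omega)) ℓ').dir))) ∧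
          ((∃ y : Site (F.P K) ((K - (J + (t + 1))) + 1), (if (q.src q.μ - emb y q.μ).val < (F.P K).L then (1 : ℝ) else 0) *
          (∏ ι ∈ (Finset.univ.erase q.μ).erase q.ν, max 0 (1 - ((rel (emb y) q.src ι).natAbs : ℝ) / (F.P K).L)) *
          (if (q.src q.ν - emb y q.ν).val < (F.P K).L then (1 : ℝ) else 0) ≠ 0 ∧ (e = ⟨y, q.μ⟩ ∨ e = ⟨y.shift q.μ, q.ν⟩ ∨ e = ⟨y.shift q.ν, q.μ⟩ ∨ e = ⟨y, q.ν⟩)) ∨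
           (∃ b : PBond (F.P K) (K - (J + (t + 1))), (b = ⟨q.src, q.μ⟩ ∨ b = ⟨q.src.shift q.μ, q.ν⟩ ∨ b = ⟨q.src.shift q.ν, q.μ⟩ ∨ b = ⟨q.src, q.ν⟩) ∧ wt (K - (J + (t + 1))) b e ≠ 0))
  · rw [if_pos hs, Real.norm_of_nonneg (GaugeGroup.dist1_nonneg _)]
    obtain ⟨q, ⟨ℓr, hread, hreg⟩, hsup⟩ := hs
    -- GEOMETRY at height `s+1` of `F.P K`: the support bond is within `3` of the box block `Y`
    have hY : ∀ κ, (rel (blockOf (bondShift (F.sitesPerDir_eq (m := F.m) (K := J + (t + 1)) (j := 0) (m' := F.m) (K' := K) (j' := (K - (J + (t + 1)))) (by omega)) ℓr).src) e.src κ).natAbs ≤ 3 := by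
      intro κ
      have h1 : (rel (blockOf (bondShift (F.sitesPerDir_eq (m := F.m) (K := J + (t + 1)) (j := 0) (m' := F.m) (K' := K) (j' := (K - (J + (t + 1)))) (by omega)) ℓr).src) (blockOf q.src) κ).natAbs ≤ 1 :=
        natAbs_rel_of_boxBlock _ _ (bondShift (F.sitesPerDir_eq (m := F.m) (K := J + (t + 1)) (j := 0) (m' := F.m) (K' := K) (j' := (K - (J + (t + 1)))) (by omega)) ℓr).dir (by
          rcases hreg with h | h
          · exact Or.inr (Or.inl h)
          · exact Or.inr (Or.inr h)) κ
      have h2 : (rel (blockOf q.src) e.src κ).natAbs ≤ 2 := by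
        rcases hsup with ⟨y, hy, he⟩ | ⟨b, hb, hbe⟩
        · have hyq : (rel (blockOf q.src) y κ).natAbs ≤ 1 := by
            rw [natAbs_rel_comm]; exact natAbs_rel_blockOf_le_one_of_colW hs1 hy κ
          have hye : (rel y e.src κ).natAbs ≤ 1 := by
            have hsrc : e.src = y ∨ e.src = y.shift q.μ ∨ e.src = y.shift q.ν := by
              rcases he with h | h | h | h
              · subst h; exact Or.inl rfl
              · subst h; exact Or.inr (Or.inl rfl)
              · subst h; exact Or.inr (Or.inr rfl)
              · subst h; exact Or.inl rfl
            exact natAbs_rel_corner_le_one y q.μ q.ν hsrc κ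
          exact (natAbs_rel_le_add _ y _ κ).trans (by omega)
        · have hqb : (rel (blockOf q.src) (blockOf b.src) κ).natAbs ≤ 1 := by
            have hsrc : b.src = q.src ∨ b.src = q.src.shift q.μ ∨ b.src = q.src.shift q.ν := by
              rcases hb with h | h | h | h
              · subst h; exact Or.inl rfl
              · subst h; exact Or.inr (Or.inl rfl)
              · subst h; exact Or.inr (Or.inr rfl)
              · subst h; exact Or.inl rfl
            exact natAbs_rel_blockOf_le hs1 _ _ κ (natAbs_rel_corner_le_one q.src q.μ q.ν hsrc κ)
          have hbe' : (rel (blockOf b.src) e.src κ).natAbs ≤ 1 := by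
            rw [natAbs_rel_comm]; exact natAbs_rel_blockOf_le_one_of_wt hs1 (wt (K - (J + (t + 1)))) (hwt (K - (J + (t + 1)))) hbe κ
          exact (natAbs_rel_le_add _ (blockOf b.src) _ κ).trans (by omega)
      exact (natAbs_rel_le_add _ (blockOf q.src) _ κ).trans (Nat.add_le_add h1 h2)
    -- the level-`J+t` copy `c` of `e`
    set c : PBond (F.P (J + t)) 0 := (bondShift Pσ).symm e with hc
    have hce : bondShift Pσ c = e := (bondShift Pσ).apply_symm_apply e
    -- `c` lies in the parent box of `B` (radius 3) with the READ′ bond `ℓr` itself as the box bond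
    have hbox : ∃ ℓ' : PBond (F.P (J + (t + 1))) 0, (∃ ℓ'' : PBond (F.P (J + (t + 1))) 0, (∃ z : Site (F.P (J + (t + 1))) 0,
                (B14.Eq22Determines.blockIter (t + 1) z = (bondShift (F.sitesPerDir_eq (m := F.m) (K := J) (j := 0) (m' := F.m) (K' := J + (t + 1)) (j' := t + 1) (by omega)) B).src ∨ B14.Eq22Determines.blockIter (t + 1) z = (bondShift (F.sitesPerDir_eq (m := F.m) (K := J) (j := 0) (m' := F.m) (K' := J + (t + 1)) (j' := t + 1) (by omega)) B).tgt) ∧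
                ∀ ν, (B10Eq27TorusAxialLog.rel z ℓ''.src ν).natAbs ≤ 2) ∧
                (blockOf ℓ'.src = (blockOf ℓ''.src).unshift ℓ''.dir ∨ blockOf ℓ'.src = blockOf ℓ''.src ∨ blockOf ℓ'.src = (blockOf ℓ''.src).shift ℓ''.dir)) ∧
                ∀ ν, (B10Eq27TorusAxialLog.rel ((siteShift (F.sitesPerDir_eq (m := F.m) (K := J + t) (j := 0) (m' := F.m) (K' := J + (t + 1)) (j' := 1) (by omega))).symm (blockOf ℓ'.src)) c.src ν).natAbs ≤ 3 := by
      refine ⟨ℓr, ⟨ℓr, hread, Or.inr (Or.inl rfl)⟩, fun ν => ?_⟩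
      have e1 := natAbs_rel_siteShift Pσ ((siteShift H).symm (blockOf ℓr.src)) c.src ν
      have e2 : siteShift Pσ c.src = e.src := by
        show siteShift Pσ ((siteShift Pσ).symm e.src) = e.src
        exact (siteShift Pσ).apply_symm_apply e.src
      have e3 : siteShift Pσ ((siteShift H).symm (blockOf ℓr.src)) = blockOf (bondShift (F.sitesPerDir_eq (m := F.m) (K := J + (t + 1)) (j := 0) (m' := F.m) (K' := K) (j' := (K - (J + (t + 1)))) (by omega)) ℓr).src := by
        rw [bondShift_src, ← siteShift_blockOf P₂ H₁]
        conv_rhs => rw [← (siteShift H).apply_symm_apply (blockOf ℓr.src)]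
        rw [siteShift_siteShift]
      rw [e2, e3] at e1
      exact e1.symm.le.trans (hY ν)
    -- currency: the parent relative chord at `e` is the station's level-`J+t` relative chord at `c`
    have hcur : dist1 ((Averaging.iter (fun k => blockAvg (P := F.P K) (j := k) ℰp) ((K - (J + (t + 1))) + 1) (fun ℓ => expPoint (ζ ℓ) * U₀ ℓ : GaugeField (F.P K) 0 (Matrix.specialUnitaryGroup (Fin 2) ℂ))) e *
        ((Averaging.iter (fun k => blockAvg (P := F.P K) (j := k) ℰp) ((K - (J + (t + 1))) + 1) U₀) e)⁻¹) ≤ ‖logVec (su2Quat (descendTo F ℰp (J + t) K (by omega) (fun ℓ => expPoint (ζ ℓ) * U₀ ℓ : GaugeField (F.P K) 0 (Matrix.specialUnitaryGroup (Fin 2) ℂ)) c * (descendTo F ℰp (J + t) K (by omega) U₀ c)⁻¹))‖ := by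
      rw [descendTo_apply_eq_iter_of_eq F hJt ha, descendTo_apply_eq_iter_of_eq F hJt ha, hce]
      exact dist1_le_norm_logVec _
    refine hcur.trans ?_
    have := norm_le_pi_norm (fun c : PBond (F.P (J + t)) 0 =>
        if ∃ ℓ' : PBond (F.P (J + (t + 1))) 0, (∃ ℓ'' : PBond (F.P (J + (t + 1))) 0, (∃ z : Site (F.P (J + (t + 1))) 0,
                (B14.Eq22Determines.blockIter (t + 1) z = (bondShift (F.sitesPerDir_eq (m := F.m) (K := J) (j := 0) (m' := F.m) (K' := J + (t + 1)) (j' := t + 1) (by omega)) B).src ∨ B14.Eq22Determines.blockIter (t + 1) z = (bondShift (F.sitesPerDir_eq (m := F.m) (K := J) (j := 0) (m' := F.m) (K' := J + (t + 1)) (j' := t + 1) (by omega)) B).tgt) ∧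
                ∀ ν, (B10Eq27TorusAxialLog.rel z ℓ''.src ν).natAbs ≤ 2) ∧
                (blockOf ℓ'.src = (blockOf ℓ''.src).unshift ℓ''.dir ∨ blockOf ℓ'.src = blockOf ℓ''.src ∨ blockOf ℓ'.src = (blockOf ℓ''.src).shift ℓ''.dir)) ∧
                ∀ ν, (B10Eq27TorusAxialLog.rel ((siteShift (F.sitesPerDir_eq (m := F.m) (K := J + t) (j := 0) (m' := F.m) (K' := J + (t + 1)) (j' := 1) (by omega))).symm (blockOf ℓ'.src)) c.src ν).natAbs ≤ 3
        then logVec (su2Quat (descendTo F ℰp (J + t) K (by omega) (fun ℓ => expPoint (ζ ℓ) * U₀ ℓ : GaugeField (F.P K) 0 (Matrix.specialUnitaryGroup (Fin 2) ℂ)) c * (descendTo F ℰp (J + t) K (by omega) U₀ c)⁻¹)) else 0) c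
    rwa [if_pos hbox] at this
  · rw [if_neg hs, norm_zero]; exact norm_nonneg _

/-- ★★ **`ρP_par(t,B) ≤` THE (k1) READ CELL ONE LEVEL UP** — the parent relative-plaquette box sup of ✓∕⧗`hρA_of_parentSups` is dominated by px10 g26's (k1) object
(✓`hρT_of_readSup`'s cell, thickness `2L + 1`) written at the PARENT height `s + 1` (same `B`, no second cover): a column plaquette sits within one block of `blockOf q.src`
(§1), and `q.src` satisfies the (k1) read clause at height `s` (px10 ✓`readCell_of_box`), whose block is within `3` of `blockIter (s+1) z₀` (`2L+1 ≤ 3L`, ✓`natAbs_rel_blockOf_le_of_le_mul`);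
`3 + 1 ≤ 2L + 1`. [cite: Balaban1987RG1, (0.1)-(0.4) p.251-253] -/
theorem rhoPpar_le_readCellParent {J K : ℕ} (U₀ : GaugeField (F.P K) 0 (Matrix.specialUnitaryGroup (Fin 2) ℂ)) (ζ : PBond (F.P K) 0 → EuclideanSpace ℝ (Fin 3))
    (t : ℕ) (ht : t < K - J) (B : PBond (F.P J) 0) :
    ‖(fun p : Plaq (F.P K) ((K - (J + (t + 1))) + 1) => if (∃ q : Plaq (F.P K) (K - (J + (t + 1))), ((∃ ℓ' : PBond (F.P (J + (t + 1))) 0, (∃ z : Site (F.P (J + (t + 1))) 0,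
                (B14.Eq22Determines.blockIter (t + 1) z = (bondShift (F.sitesPerDir_eq (m := F.m) (K := J) (j := 0) (m' := F.m) (K' := J + (t + 1)) (j' := t + 1) (by omega)) B).src ∨ B14.Eq22Determines.blockIter (t + 1) z = (bondShift (F.sitesPerDir_eq (m := F.m) (K := J) (j := 0) (m' := F.m) (K' := J + (t + 1)) (j' := t + 1) (by omega)) B).tgt) ∧
                ∀ ν, (B10Eq27TorusAxialLog.rel z ℓ'.src ν).natAbs ≤ 2) ∧
        (blockOf q.src = blockOf (bondShift (F.sitesPerDir_eq (m := F.m) (K := J + (t + 1)) (j := 0) (m' := F.m) (K' := K) (j' := (K - (J + (t + 1)))) (by omega)) ℓ').src ∨ blockOf q.src = (blockOf (bondShift (F.sitesPerDir_eq (m := F.m) (K := J + (t + 1)) (j := 0) (m' := F.m) (K' := K) (j' := (K - (J + (t + 1)))) (by omega)) ℓ').src).shift (bondShift (F.sitesPerDir_eq (m := F.m) (K := J + (t + 1)) (j := 0) (m' := F.m) (K' := K) (j' := (K - (J + (t + 1)))) (by omega)) ℓ').dir))) ∧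
          (if (q.src q.μ - emb p.src q.μ).val < (F.P K).L then (1 : ℝ) else 0) *
          (∏ ι ∈ (Finset.univ.erase q.μ).erase q.ν, max 0 (1 - ((rel (emb p.src) q.src ι).natAbs : ℝ) / (F.P K).L)) *
          (if (q.src q.ν - emb p.src q.ν).val < (F.P K).L then (1 : ℝ) else 0) ≠ 0 ∧ p.μ = q.μ ∧ p.ν = q.ν) then dist1 ((GaugeField.plaqHol (Averaging.iter (fun k => blockAvg (P := F.P K) (j := k) ℰp) ((K - (J + (t + 1))) + 1) U₀) p)⁻¹ * GaugeField.plaqHol (Averaging.iter (fun k => blockAvg (P := F.P K) (j := k) ℰp) ((K - (J + (t + 1))) + 1) (fun ℓ => expPoint (ζ ℓ) * U₀ ℓ : GaugeField (F.P K) 0 (Matrix.specialUnitaryGroup (Fin 2) ℂ))) p) else 0)‖ ≤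
      ‖(fun p : Plaq (F.P K) ((K - (J + (t + 1))) + 1) => if ∃ z₀ : Site (F.P K) 0, (B14.Eq22Determines.blockIter (K - J) z₀ = (bondShift (F.sitesPerDir_eq (m := F.m) (K := J) (j := 0) (m' := F.m) (K' := K) (j' := K - J) (by omega)) B).src ∨
            B14.Eq22Determines.blockIter (K - J) z₀ = (bondShift (F.sitesPerDir_eq (m := F.m) (K := J) (j := 0) (m' := F.m) (K' := K) (j' := K - J) (by omega)) B).tgt) ∧
            ∀ κ, (rel (B14.Eq22Determines.blockIter ((K - (J + (t + 1))) + 1) z₀) p.src κ).natAbs ≤ 2 * F.L + 1 then dist1 ((GaugeField.plaqHol (Averaging.iter (fun k => blockAvg (P := F.P K) (j := k) ℰp) ((K - (J + (t + 1))) + 1) U₀) p)⁻¹ * GaugeField.plaqHol (Averaging.iter (fun k => blockAvg (P := F.P K) (j := k) ℰp) ((K - (J + (t + 1))) + 1) (fun ℓ => expPoint (ζ ℓ) * U₀ ℓ : GaugeField (F.P K) 0 (Matrix.specialUnitaryGroup (Fin 2) ℂ))) p) else 0)‖ := by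
  classical
  have hs1 : (K - (J + (t + 1))) + 1 ≤ (F.P K).m + (F.P K).K := by show (K - (J + (t + 1))) + 1 ≤ F.m + K; omega
  have h2L : 2 ≤ F.L := by have := F.hL; omega
  refine (pi_norm_le_iff_of_nonneg (norm_nonneg _)).mpr fun p => ?_
  by_cases hs : ∃ q : Plaq (F.P K) (K - (J + (t + 1))), ((∃ ℓ' : PBond (F.P (J + (t + 1))) 0, (∃ z : Site (F.P (J + (t + 1))) 0,
                (B14.Eq22Determines.blockIter (t + 1) z = (bondShift (F.sitesPerDir_eq (m := F.m) (K := J) (j := 0) (m' := F.m) (K' := J + (t + 1)) (j' := t + 1) (by omega)) B).src ∨ B14.Eq22Determines.blockIter (t + 1) z = (bondShift (F.sitesPerDir_eq (m := F.m) (K := J) (j := 0) (m' := F.m) (K' := J + (t + 1)) (j' := t + 1) (by omega)) B).tgt) ∧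
                ∀ ν, (B10Eq27TorusAxialLog.rel z ℓ'.src ν).natAbs ≤ 2) ∧
        (blockOf q.src = blockOf (bondShift (F.sitesPerDir_eq (m := F.m) (K := J + (t + 1)) (j := 0) (m' := F.m) (K' := K) (j' := (K - (J + (t + 1)))) (by omega)) ℓ').src ∨ blockOf q.src = (blockOf (bondShift (F.sitesPerDir_eq (m := F.m) (K := J + (t + 1)) (j := 0) (m' := F.m) (K' := K) (j' := (K - (J + (t + 1)))) (by omega)) ℓ').src).shift (bondShift (F.sitesPerDir_eq (m := F.m) (K := J + (t + 1)) (j := 0) (m' := F.m) (K' := K) (j' := (K - (J + (t + 1)))) (by omega)) ℓ').dir))) ∧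
          (if (q.src q.μ - emb p.src q.μ).val < (F.P K).L then (1 : ℝ) else 0) *
          (∏ ι ∈ (Finset.univ.erase q.μ).erase q.ν, max 0 (1 - ((rel (emb p.src) q.src ι).natAbs : ℝ) / (F.P K).L)) *
          (if (q.src q.ν - emb p.src q.ν).val < (F.P K).L then (1 : ℝ) else 0) ≠ 0 ∧ p.μ = q.μ ∧ p.ν = q.ν
  · rw [if_pos hs, Real.norm_of_nonneg (GaugeGroup.dist1_nonneg _)]
    obtain ⟨q, ⟨ℓr, hread, hreg⟩, hy, -, -⟩ := hs
    obtain ⟨z₀, hends, hq⟩ := readCell_of_box F ht B q ⟨ℓr, hread, by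
      rcases hreg with h | h
      · exact Or.inr (Or.inl h)
      · exact Or.inr (Or.inr h)⟩
    have hcell : ∃ z₀ : Site (F.P K) 0, (B14.Eq22Determines.blockIter (K - J) z₀ = (bondShift (F.sitesPerDir_eq (m := F.m) (K := J) (j := 0) (m' := F.m) (K' := K) (j' := K - J) (by omega)) B).src ∨
            B14.Eq22Determines.blockIter (K - J) z₀ = (bondShift (F.sitesPerDir_eq (m := F.m) (K := J) (j := 0) (m' := F.m) (K' := K) (j' := K - J) (by omega)) B).tgt) ∧
            ∀ κ, (rel (B14.Eq22Determines.blockIter ((K - (J + (t + 1))) + 1) z₀) p.src κ).natAbs ≤ 2 * F.L + 1 := by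
      refine ⟨z₀, hends, fun κ => ?_⟩
      have h3 : (rel (B14.Eq22Determines.blockIter ((K - (J + (t + 1))) + 1) z₀) (blockOf q.src) κ).natAbs ≤ 3 := by
        rw [B14.Eq22Determines.blockIter_succ]
        refine natAbs_rel_blockOf_le_of_le_mul hs1 _ _ κ 3 ((hq κ).trans ?_)
        have : (F.P K).L = F.L := rfl
        omega
      have h1 : (rel (blockOf q.src) p.src κ).natAbs ≤ 1 := by
        rw [natAbs_rel_comm]; exact natAbs_rel_blockOf_le_one_of_colW hs1 hy κ
      exact (natAbs_rel_le_add _ (blockOf q.src) _ κ).trans (by omega)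
    have := norm_le_pi_norm (fun p : Plaq (F.P K) ((K - (J + (t + 1))) + 1) => if ∃ z₀ : Site (F.P K) 0, (B14.Eq22Determines.blockIter (K - J) z₀ = (bondShift (F.sitesPerDir_eq (m := F.m) (K := J) (j := 0) (m' := F.m) (K' := K) (j' := K - J) (by omega)) B).src ∨
            B14.Eq22Determines.blockIter (K - J) z₀ = (bondShift (F.sitesPerDir_eq (m := F.m) (K := J) (j := 0) (m' := F.m) (K' := K) (j' := K - J) (by omega)) B).tgt) ∧
            ∀ κ, (rel (B14.Eq22Determines.blockIter ((K - (J + (t + 1))) + 1) z₀) p.src κ).natAbs ≤ 2 * F.L + 1 then dist1 ((GaugeField.plaqHol (Averaging.iter (fun k => blockAvg (P := F.P K) (j := k) ℰp) ((K - (J + (t + 1))) + 1) U₀) p)⁻¹ * GaugeField.plaqHol (Averaging.iter (fun k => blockAvg (P := F.P K) (j := k) ℰp) ((K - (J + (t + 1))) + 1) (fun ℓ => expPoint (ζ ℓ) * U₀ ℓ : GaugeField (F.P K) 0 (Matrix.specialUnitaryGroup (Fin 2) ℂ))) p) else 0) p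
    rwa [if_pos hcell, Real.norm_of_nonneg (GaugeGroup.dist1_nonneg _)] at this
  · rw [if_neg hs, norm_zero]; exact norm_nonneg _

end Tower

end Summit.QuantumFields.YangMills.Theorems.FluctuationComparisonRegPrIntLS2BetaRhoAColumnCovers
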